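import Mathlib
import Literature.Computability.AlgebraicComplexity.GroupTheoreticMatMul
import Summits.MatrixMultiplication.OmegaCensus.STPPCertificateCheck

/-!
# STPP families made of LABELLED TRANSLATES of one TPP triple (cell mm-stpp, eng-1 g6; R-5 (Q-i) existence side)

If `(A, B, C)` is a TPP triple in an abelian group `G` (here: the one-member family `![A], ![B], ![C]` is
`IsSTPP`) and `β γ : Fin N → G` are labels such that every label combination
`(β j − β i) + (γ k − γ j)` with `(i, j, k)` not all equal avoids the difference set
`D = (A − A) + ((B − B) + (C − C))` of the box `A + B + C`, then the `N` translated triples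
`(A, B + β t, C + γ t)` form an `IsSTPP` family.  This is the mechanism behind the smallest STPP pairs of
small cubes found by the cell's existence search (e.g. `(2,2,2)²` in `ℤ/24`: `A = {0,5}`, `B = {0,10}`,
`C = {0,12}`, labels `β = (0,4)`, `γ = (0,8)`), and it contains the product construction `K × ℤ/n`
(labels in a separate coordinate) as the special case `D ⊆ K × {0}`.  It can only work in the THIN regime
`2|A||B||C| ≤ |G|`: a box of more than half the group has `D = G`.

Kernel witnesses below: the `(2,2,2)` pair at order 24, and LATIN COSET `(s,s,s)³` designs at order `4s³` for `s = 2, 3, 4`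
(`decide +kernel` through the tree's reflected checker `stppCheckQ`); the same constructor's `s = 5, 6, 7, 8` families
(orders 500, 864, 1372, 2048) pass two independent STPP checkers but are too large for a kernel `decide` here (DATA).

WHAT THIS IS NOT: no statement about ω; no census number; an existence TOOL and existence UPPER ENDS, not an exclusion;
none of these families beats 5/2 (they are THIN: `2·|A||B||C| ≤ |G|`).
-/

-- single-conjunct summit: the mandated namespace repeats `MatrixMultiplication`.
set_option linter.dupNamespace false

namespace Summit.MatrixMultiplication.MatrixMultiplication.Theorems.STPPExistenceDesigns

open Finset
open scoped Pointwise
open Literature.Computability.AlgebraicComplexity (IsSTPP)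
open Summit.MatrixMultiplication.OmegaCensus (stppCheckQ isSTPP_of_stppCheckQ)

variable {G : Type*} [AddCommGroup G] [DecidableEq G] {N : ℕ}

/-- **Labelled translates of a TPP triple.**  Let `![A], ![B], ![C]` be `IsSTPP` (i.e. `(A,B,C)` has the
triple product property) and let `β γ : Fin N → G`.  If for all `(i,j,k)` not all equal and all
`d ∈ (A − A) + ((B − B) + (C − C))` one has `d + ((β j − β i) + (γ k − γ j)) ≠ 0`, then the family
`t ↦ (A, β t +ᵥ B, γ t +ᵥ C)` is `IsSTPP`. [original] -/
theorem isSTPP_translates (A B C : Finset G) (hT : IsSTPP ![A] ![B] ![C]) (β γ : Fin N → G)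
    (hΛ : ∀ i j k : Fin N, ¬ (i = j ∧ j = k) →
      ∀ d ∈ (A - A) + ((B - B) + (C - C)), d + ((β j - β i) + (γ k - γ j)) ≠ 0) :
    IsSTPP (fun _ : Fin N => A) (fun t => β t +ᵥ B) (fun t => γ t +ᵥ C) := by
  intro i j k s hs s' hs' t ht t' ht' u hu u' hu' hrel
  simp only [Finset.mem_vadd_finset, vadd_eq_add] at ht ht' hu hu'
  obtain ⟨b, hb, rfl⟩ := ht
  obtain ⟨b', hb', rfl⟩ := ht'
  obtain ⟨c, hc, rfl⟩ := hu
  obtain ⟨c', hc', rfl⟩ := hu'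
  -- the relation reads  d + λ = 0  with  d = (s' - s) + ((b' - b) + (c' - c)) ∈ D
  have hd : (s' - s) + ((b' - b) + (c' - c)) ∈ (A - A) + ((B - B) + (C - C)) :=
    Finset.add_mem_add (Finset.sub_mem_sub hs' hs)
      (Finset.add_mem_add (Finset.sub_mem_sub hb' hb) (Finset.sub_mem_sub hc' hc))
  have key : (s' - s) + ((b' - b) + (c' - c)) + ((β j - β i) + (γ k - γ j)) = 0 := by
    rw [← hrel]; abel
  by_cases hijk : i = j ∧ j = k
  · obtain ⟨rfl, rfl⟩ := hijk
    -- all labels cancel: the relation is a TPP relation of (A,B,C)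
    have hrel' : (s' - s) + (b' - b) + (c' - c) = 0 := by
      have := key; simp only [sub_self, add_zero] at this; rw [← this]; abel
    have h1 := hT 0 0 0 s (by simpa using hs) s' (by simpa using hs') b (by simpa using hb) b'
      (by simpa using hb') c (by simpa using hc) c' (by simpa using hc') hrel'
    obtain ⟨-, -, h2, h3, h4⟩ := h1
    exact ⟨rfl, rfl, h2, by rw [h3], by rw [h4]⟩
  · exact absurd key (hΛ i j k hijk _ hd)


/-! ## Kernel witnesses (explicit families; `stppCheckQ` = the tree's reflected Boolean transcription of CKSU Def. 5.1,
`isSTPP_of_stppCheckQ` its reflection lemma; every `decide` below runs in the kernel) -/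

/-- Packaging: lists accepted by `stppCheckQ` whose finsets have the stated cardinalities give an existential
`IsSTPP` statement with those block sizes. [folklore] -/
theorem exists_isSTPP_of_lists {H : Type*} [AddCommGroup H] [DecidableEq H] {N : ℕ} (a b c : ℕ)
    (LA LB LC : Fin N → List H) (hS : stppCheckQ LA LB LC = true)
    (hc : ∀ i, (LA i).toFinset.card = a ∧ (LB i).toFinset.card = b ∧ (LC i).toFinset.card = c) :
    ∃ A B C : Fin N → Finset H, IsSTPP A B C ∧ ∀ i, (A i).card = a ∧ (B i).card = b ∧ (C i).card = c :=
  ⟨_, _, _, isSTPP_of_stppCheckQ hS, hc⟩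

/-- **`(2,2,2)²` at order 24** (the least order at which the cell's search finds an STPP pair of `(2,2,2)` cubes;
search-grade null below 24): `ℤ/24`, `A = ({0,5},{0,5})`, `B = ({0,10},{4,14})`, `C = ({0,12},{8,20})` — labelled
translates `(A, B + β_t, C + γ_t)` of the TPP triple `({0,5},{0,10},{0,12})`, `β = (0,4)`, `γ = (0,8)`
(`isSTPP_translates`). [original] -/
theorem exists_isSTPP_222pair_order24 :
    ∃ A B C : Fin 2 → Finset (ZMod 24), IsSTPP A B C ∧ ∀ i, (A i).card = 2 ∧ (B i).card = 2 ∧ (C i).card = 2 :=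
  exists_isSTPP_of_lists 2 2 2 ![[0, 5], [0, 5]] ![[0, 10], [4, 14]] ![[0, 12], [8, 20]]
    (by decide +kernel) (by decide +kernel)

-- (2,2,2)³ at order 32 = 4·2³ in (ℤ/2)⁵ is already a kernel fact of the pub-omega census:
-- `Summit.MatrixMultiplication.OmegaCensus.exists_isSTPP_222cube_zmod2_pow5` (STPP222CubeBelow46.lean) — not restated here.

/-- **`(3,3,3)³` at order 108 = 4·3³** in `(ℤ/3)³ × (ℤ/2)²`: a LATIN COSET DESIGN — every block is a coset of one of the
three coordinate subgroups `K₀, K₁, K₂ ≅ ℤ/3` of `(ℤ/3)³`, member `t` uses `(K_t, K_{t+1}, K_{t+2})` for `(A,B,C)`,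
labels in the quotient `(ℤ/2)²` (+ in-`(ℤ/3)³` shifts) chosen by the cell's constructor `construct_latin3.py` and
double-checked by two independent STPP checkers before this kernel check. [original] -/
theorem exists_isSTPP_333triple_order108 :
    ∃ A B C : Fin 3 → Finset (ZMod 3 × ZMod 3 × ZMod 3 × ZMod 2 × ZMod 2), IsSTPP A B C ∧
      ∀ i, (A i).card = 3 ∧ (B i).card = 3 ∧ (C i).card = 3 :=
  exists_isSTPP_of_lists (H := ZMod 3 × ZMod 3 × ZMod 3 × ZMod 2 × ZMod 2) 3 3 3
    ![[(1, 0, 0, 0, 0), (2, 0, 0, 0, 0), (0, 0, 0, 0, 0)],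
      [(2, 2, 2, 1, 0), (2, 0, 2, 1, 0), (2, 1, 2, 1, 0)],
      [(2, 0, 0, 1, 1), (2, 0, 1, 1, 1), (2, 0, 2, 1, 1)]]
    ![[(1, 1, 2, 1, 0), (1, 2, 2, 1, 0), (1, 0, 2, 1, 0)],
      [(0, 2, 1, 1, 0), (0, 2, 2, 1, 0), (0, 2, 0, 1, 0)],
      [(2, 0, 2, 0, 0), (0, 0, 2, 0, 0), (1, 0, 2, 0, 0)]]
    ![[(1, 2, 1, 1, 0), (1, 2, 2, 1, 0), (1, 2, 0, 1, 0)],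
      [(1, 2, 1, 1, 1), (2, 2, 1, 1, 1), (0, 2, 1, 1, 1)],
      [(1, 0, 0, 1, 1), (1, 1, 0, 1, 1), (1, 2, 0, 1, 1)]]
    (by decide +kernel) (by decide +kernel)

/-- **`(4,4,4)³` at order 256 = 4·4³** in `(ℤ/4)³ × (ℤ/2)²`: a LATIN COSET DESIGN — every block is a coset of one of the
three coordinate subgroups `K₀, K₁, K₂ ≅ ℤ/4` of `(ℤ/4)³`, member `t` uses `(K_t, K_{t+1}, K_{t+2})` for `(A,B,C)`,
labels in the quotient `(ℤ/2)²` (+ in-`(ℤ/4)³` shifts) chosen by the cell's constructor `construct_latin3.py` and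
double-checked by two independent STPP checkers before this kernel check. [original] -/
theorem exists_isSTPP_444triple_order256 :
    ∃ A B C : Fin 3 → Finset (ZMod 4 × ZMod 4 × ZMod 4 × ZMod 2 × ZMod 2), IsSTPP A B C ∧
      ∀ i, (A i).card = 4 ∧ (B i).card = 4 ∧ (C i).card = 4 :=
  exists_isSTPP_of_lists (H := ZMod 4 × ZMod 4 × ZMod 4 × ZMod 2 × ZMod 2) 4 4 4
    ![[(0, 3, 2, 0, 0), (1, 3, 2, 0, 0), (2, 3, 2, 0, 0), (3, 3, 2, 0, 0)],
      [(2, 3, 0, 1, 0), (2, 0, 0, 1, 0), (2, 1, 0, 1, 0), (2, 2, 0, 1, 0)],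
      [(2, 1, 1, 0, 1), (2, 1, 2, 0, 1), (2, 1, 3, 0, 1), (2, 1, 0, 0, 1)]]
    ![[(1, 2, 1, 0, 1), (1, 3, 1, 0, 1), (1, 0, 1, 0, 1), (1, 1, 1, 0, 1)],
      [(0, 1, 1, 1, 0), (0, 1, 2, 1, 0), (0, 1, 3, 1, 0), (0, 1, 0, 1, 0)],
      [(3, 2, 3, 1, 1), (0, 2, 3, 1, 1), (1, 2, 3, 1, 1), (2, 2, 3, 1, 1)]]
    ![[(1, 1, 0, 1, 1), (1, 1, 1, 1, 1), (1, 1, 2, 1, 1), (1, 1, 3, 1, 1)],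
      [(0, 0, 3, 1, 1), (1, 0, 3, 1, 1), (2, 0, 3, 1, 1), (3, 0, 3, 1, 1)],
      [(3, 2, 0, 1, 1), (3, 3, 0, 1, 1), (3, 0, 0, 1, 1), (3, 1, 0, 1, 1)]]
    (by decide +kernel) (by decide +kernel)

end Summit.MatrixMultiplication.MatrixMultiplication.Theorems.STPPExistenceDesigns
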